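import Summits.Ventures.LatticeQCDFlow.Exactness.ReversibleNeumannSums
import Summits.Ventures.LatticeQCDFlow.Exactness.ReversibleAutocovMonotone
import HarnessLib

/-!
# POSITIVE reversible exact samplers: every autocovariance sequence is nonnegative, nonincreasing, convex and log-convex

HONEST FRAMING: exact (Metropolis-corrected) sampling algorithms for lattice gauge theory;
figures of merit are autocorrelation/cost numbers at stated couplings and volumes; no
continuum-physics claim.  (SCALAR calibration rung S0-A: not a gauge result.)

Venture `LatticeQCDFlow` (cell pub-lqcd), topic `Exactness`; FANOUT row 2 (`s0-phi4`).  NEW WORK of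
the cell in the `RevOp` format of a reversible exact sampler (`Exactness/ReversibleOperatorL2.lean`:
weight `w ≥ 0`, admissible class `A` with (int) (comb), operator `K` with (stab) (lin) (symm)
(contr)), under ONE extra hypothesis:

  (pos)  `0 ≤ ∫ f (K f) w` for every `f ∈ A` — `K` is a POSITIVE operator on the class.

(pos) holds for the flow arm (independence Metropolis: `Exactness/FlowSamplerPositive.lean`), for
heat-bath / random-scan Gibbs updates, for every two-step operator `K²` and every lazy chain
`(K + 1)/2`, and — the lattice theorem of this generation — for the random-site Metropolis scan of
lattice φ⁴ whenever the step law is a symmetric convolution square (Gaussian steps included).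
Nothing is cited as a fact; only Cauchy–Schwarz on the class.  Printed counterparts NAMED ONLY:
Rudolf–Ullrich 2013 (Electron. Commun. Probab. 18, no. 49, §2: positive operators have nonnegative
spectrum, hence nonnegative, nonincreasing, convex autocovariances by the spectral theorem);
Liu 1996 (independence sampler); Geyer 1992 (Statist. Sci. 7, §3).  The flow-arm special case for
BOUNDED observables (`autocov_nonneg`, `autocov_logConvex` of `Exactness/FlowSamplerLogConvex.lean`)
is the instance `K = imhOp`; here the format level, so that every positive sampler of the tree
inherits the conclusions on its admissible class (polynomial observables included).

## What is proved (namespace `RevOp`; `a(k) = ∫ u (Kᵏ u) w` for `u ∈ A`)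

* §1 `autocov_shift` (transport `∫ (Kᵐu)(Kʲ Kᵐu) w = a(2m+j)`), `integral_mul_op_le_sq`
  (`∫ u (K u) w ≤ ∫ u² w`), **`kform_sq_le_of_pos`** (Cauchy–Schwarz for the positive form
  `(u, v) ↦ ∫ u (K v) w` on the class);
* §2 under (pos): **`autocov_nonneg_of_pos`** (`a(k) ≥ 0` for EVERY lag), **`autocov_convex_of_pos`**
  (`a(k) − 2a(k+1) + a(k+2) ≥ 0`), **`autocov_succ_le_of_pos`** (`a(k+1) ≤ a(k)`: a positive sampler
  decorrelates MONOTONICALLY — no observable ever becomes anti-correlated with its past),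
  `autocov_le_sq_of_pos` (`a(k) ≤ a(0)`), **`autocov_logConvex_of_pos`** (`a(k+1)² ≤ a(k)a(k+2)`);
* the normalised consequences (`ρ(1)ᵏ ≤ ρ(k)`, monotone windows that are all floors of `τ_int`,
  `τ_int ≥ ½`, the geometric floor from summability alone, bounded windows ⇒ summability) are
  `Exactness/ReversiblePositiveTauInt.lean`.

NOT CLAIMED: (pos) for HMC or for the local arm with a uniform-window step law (false in general:
negative lag-one autocorrelations occur); any rate of decay; any number for any run.
-/

namespace Summit.Ventures.LatticeQCDFlow.Exactness

open Real MeasureTheory Filter Finset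
open Summit.Ventures.LatticeQCDFlow.Scoring

namespace RevOp

variable {X : Type*} [MeasurableSpace X] {μ : Measure X} {w : X → ℝ} {A : (X → ℝ) → Prop}
  {K : (X → ℝ) → (X → ℝ)}

/-! ## §1 Transport, the Dirichlet form, and Cauchy–Schwarz for the positive form -/

/-- **Transport along the chain**: `∫ (Kᵐ u)(Kʲ (Kᵐ u)) w = a(2m + j)` (two-time form). -/
theorem autocov_shift (hAK : ∀ ⦃f : X → ℝ⦄, A f → A (K f))
    (hsymm : ∀ ⦃f h : X → ℝ⦄, A f → A h →
      ∫ x, K f x * h x * w x ∂μ = ∫ x, f x * K h x * w x ∂μ)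
    {u : X → ℝ} (hu : A u) (m j : ℕ) :
    ∫ x, (K^[m] u) x * (K^[j] (K^[m] u)) x * w x ∂μ = ∫ x, u x * (K^[2 * m + j] u) x * w x ∂μ := by
  have h2 := two_time hAK hsymm hu m (j + m)
  simp only [← Function.iterate_add_apply] at h2 ⊢
  rw [h2, show m + (j + m) = 2 * m + j by ring]

/-- **The Dirichlet form is nonnegative**: `∫ u (K u) w ≤ ∫ u² w` on the class (Cauchy–Schwarz and
(contr)). -/
theorem integral_mul_op_le_sq (hw0 : ∀ x, 0 ≤ w x)
    (hAi : ∀ ⦃f h : X → ℝ⦄, A f → A h → Integrable (fun x => f x * h x * w x) μ)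
    (hAK : ∀ ⦃f : X → ℝ⦄, A f → A (K f))
    (hcontr : ∀ ⦃f : X → ℝ⦄, A f → ∫ x, K f x ^ 2 * w x ∂μ ≤ ∫ x, f x ^ 2 * w x ∂μ)
    {u : X → ℝ} (hu : A u) :
    ∫ x, u x * K u x * w x ∂μ ≤ ∫ x, u x ^ 2 * w x ∂μ := by
  have h := quadForm_nonneg hw0 hAi hAK hcontr hu zero_le_one le_rfl
  linarith

/-- **Cauchy–Schwarz for the positive form** `(u, v) ↦ ∫ u (K v) w` on the class:
`(∫ u (K v) w)² ≤ (∫ u (K u) w)(∫ v (K v) w)` (discriminant of `t ↦ ∫ (u + t v) K(u + t v) w ≥ 0`). -/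
theorem kform_sq_le_of_pos
    (hAi : ∀ ⦃f h : X → ℝ⦄, A f → A h → Integrable (fun x => f x * h x * w x) μ)
    (hAc : ∀ ⦃f h : X → ℝ⦄ (c : ℝ), A f → A h → A (fun x => f x + c * h x))
    (hAK : ∀ ⦃f : X → ℝ⦄, A f → A (K f))
    (hlin : ∀ ⦃f h : X → ℝ⦄ (c : ℝ), A f → A h →
      ∀ x, K (fun s => f s + c * h s) x = K f x + c * K h x)
    (hsymm : ∀ ⦃f h : X → ℝ⦄, A f → A h →
      ∫ x, K f x * h x * w x ∂μ = ∫ x, f x * K h x * w x ∂μ)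
    (hpos : ∀ ⦃f : X → ℝ⦄, A f → 0 ≤ ∫ x, f x * K f x * w x ∂μ)
    {u v : X → ℝ} (hu : A u) (hv : A v) :
    (∫ x, u x * K v x * w x ∂μ) ^ 2
      ≤ (∫ x, u x * K u x * w x ∂μ) * ∫ x, v x * K v x * w x ∂μ := by
  have hKu := hAK hu
  have hKv := hAK hv
  set P := ∫ x, u x * K u x * w x ∂μ with hP
  set B := ∫ x, u x * K v x * w x ∂μ with hB
  set D := ∫ x, v x * K v x * w x ∂μ with hD
  have hvu : ∫ x, v x * K u x * w x ∂μ = B := by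
    rw [hB, ← hsymm hu hv]
    refine integral_congr_ae (Eventually.of_forall fun x => ?_)
    dsimp only
    ring
  have key : ∀ t : ℝ, 0 ≤ D * (t * t) + 2 * B * t + P := by
    intro t
    have hy : A (fun s => u s + t * v s) := hAc t hu hv
    have h0 := hpos hy
    have e1 : ∀ x, (u x + t * v x) * K (fun s => u s + t * v s) x * w x
        = u x * K u x * w x + t * (u x * K v x * w x) + t * (v x * K u x * w x)
          + t * t * (v x * K v x * w x) := by
      intro x
      rw [hlin t hu hv x]
      ring
    have i1 : Integrable (fun x => u x * K u x * w x) μ := hAi hu hKu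
    have i2 : Integrable (fun x => t * (u x * K v x * w x)) μ := (hAi hu hKv).const_mul _
    have i3 : Integrable (fun x => t * (v x * K u x * w x)) μ := (hAi hv hKu).const_mul _
    have i4 : Integrable (fun x => t * t * (v x * K v x * w x)) μ := (hAi hv hKv).const_mul _
    have i12 : Integrable (fun x => u x * K u x * w x + t * (u x * K v x * w x)) μ := i1.add i2
    have i123 : Integrable (fun x => u x * K u x * w x + t * (u x * K v x * w x)
        + t * (v x * K u x * w x)) μ := i12.add i3
    have e : ∫ x, (u x + t * v x) * K (fun s => u s + t * v s) x * w x ∂μ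
        = P + t * B + t * B + t * t * D := by
      rw [integral_congr_ae (Eventually.of_forall e1), integral_add i123 i4, integral_add i12 i3,
        integral_add i1 i2, integral_const_mul, integral_const_mul, integral_const_mul, hvu]
    rw [e] at h0
    linarith
  have hd := discrim_le_zero key
  rw [discrim] at hd
  nlinarith [hd]

/-! ## §2 Under (pos): nonnegative, convex, nonincreasing, log-convex autocovariances -/

/-- **Every autocovariance of a positive sampler is nonnegative**: `0 ≤ a(k) = ∫ u (Kᵏ u) w`
(even lags are squares `‖Kᵐu‖²`, odd lags are `⟨Kᵐu, K Kᵐu⟩ ≥ 0` by (pos)). -/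
theorem autocov_nonneg_of_pos (hw0 : ∀ x, 0 ≤ w x)
    (hAK : ∀ ⦃f : X → ℝ⦄, A f → A (K f))
    (hsymm : ∀ ⦃f h : X → ℝ⦄, A f → A h →
      ∫ x, K f x * h x * w x ∂μ = ∫ x, f x * K h x * w x ∂μ)
    (hpos : ∀ ⦃f : X → ℝ⦄, A f → 0 ≤ ∫ x, f x * K f x * w x ∂μ)
    {u : X → ℝ} (hu : A u) (k : ℕ) :
    0 ≤ ∫ x, u x * (K^[k] u) x * w x ∂μ := by
  obtain ⟨m, rfl | rfl⟩ := Nat.even_or_odd' k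
  · rw [← Nat.add_zero (2 * m), ← autocov_shift hAK hsymm hu m 0]
    exact integral_nonneg fun x => by
      simp only [Function.iterate_zero, id_eq]
      exact mul_nonneg (mul_self_nonneg _) (hw0 x)
  · rw [← autocov_shift hAK hsymm hu m 1]
    simp only [Function.iterate_one]
    exact hpos (iterate_mem hAK m hu)

/-- **Convexity of the autocovariance sequence of a positive sampler**:
`a(k+1) − a(k+2) ≤ a(k) − a(k+1)` for every lag (`y = K v − v`, `v = Kᵐ u`: the second
difference is `‖y‖²` at even `k = 2m` and `⟨y, K y⟩ ≥ 0` at odd `k = 2m + 1`). -/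
theorem autocov_convex_of_pos (hw0 : ∀ x, 0 ≤ w x)
    (hAi : ∀ ⦃f h : X → ℝ⦄, A f → A h → Integrable (fun x => f x * h x * w x) μ)
    (hAc : ∀ ⦃f h : X → ℝ⦄ (c : ℝ), A f → A h → A (fun x => f x + c * h x))
    (hAK : ∀ ⦃f : X → ℝ⦄, A f → A (K f))
    (hlin : ∀ ⦃f h : X → ℝ⦄ (c : ℝ), A f → A h →
      ∀ x, K (fun s => f s + c * h s) x = K f x + c * K h x)
    (hsymm : ∀ ⦃f h : X → ℝ⦄, A f → A h →
      ∫ x, K f x * h x * w x ∂μ = ∫ x, f x * K h x * w x ∂μ)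
    (hpos : ∀ ⦃f : X → ℝ⦄, A f → 0 ≤ ∫ x, f x * K f x * w x ∂μ)
    {u : X → ℝ} (hu : A u) (k : ℕ) :
    (∫ x, u x * (K^[k + 1] u) x * w x ∂μ) - ∫ x, u x * (K^[k + 2] u) x * w x ∂μ
      ≤ (∫ x, u x * (K^[k] u) x * w x ∂μ) - ∫ x, u x * (K^[k + 1] u) x * w x ∂μ := by
  obtain ⟨m, rfl | rfl⟩ := Nat.even_or_odd' k
  · -- even lag: second difference = ‖K v − v‖² with v = Kᵐ u
    have hv := iterate_mem hAK m hu
    have h0 : 0 ≤ ∫ x, (K (K^[m] u) x + (-1) * (K^[m] u) x)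
        * (K^[0] (fun s => K (K^[m] u) s + (-1) * (K^[m] u) s)) x * w x ∂μ :=
      integral_nonneg fun x => by
        simp only [Function.iterate_zero, id_eq]
        exact mul_nonneg (mul_self_nonneg _) (hw0 x)
    rw [autocov_test_observable hAi hAK hlin hsymm hv (-1) 0, autocov_shift hAK hsymm hu m,
      autocov_shift hAK hsymm hu m, autocov_shift hAK hsymm hu m] at h0
    rw [show 2 * m + 1 = 2 * m + 0 + 1 by ring, show 2 * m + 2 = 2 * m + 0 + 2 by ring]
    norm_num at h0 ⊢
    linarith
  · -- odd lag: second difference = ⟨y, K y⟩ with y = K v − v, v = Kᵐ u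
    have hv := iterate_mem hAK m hu
    have hy : A (fun s => K (K^[m] u) s + (-1) * (K^[m] u) s) := hAc (-1) (hAK hv) hv
    have h0 := hpos hy
    have e : ∫ x, (K (K^[m] u) x + (-1) * (K^[m] u) x)
        * K (fun s => K (K^[m] u) s + (-1) * (K^[m] u) s) x * w x ∂μ
        = ∫ x, (K (K^[m] u) x + (-1) * (K^[m] u) x)
          * (K^[1] (fun s => K (K^[m] u) s + (-1) * (K^[m] u) s)) x * w x ∂μ := by
      simp only [Function.iterate_one]
    rw [e, autocov_test_observable hAi hAK hlin hsymm hv (-1) 1, autocov_shift hAK hsymm hu m,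
      autocov_shift hAK hsymm hu m, autocov_shift hAK hsymm hu m] at h0
    rw [show 2 * m + 1 + 1 = 2 * m + 2 by ring, show 2 * m + 1 + 2 = 2 * m + 3 by ring]
    norm_num at h0 ⊢
    linarith

/-- **A positive sampler decorrelates monotonically**: `a(k+1) ≤ a(k)` for every lag and every
admissible observable (even lags: the Dirichlet form of `Kᵐu`; odd lags: convexity at `2m + 1` and
the even case at `m + 1`).  No observable is ever anti-correlated with its own past. -/
theorem autocov_succ_le_of_pos (hw0 : ∀ x, 0 ≤ w x)
    (hAi : ∀ ⦃f h : X → ℝ⦄, A f → A h → Integrable (fun x => f x * h x * w x) μ)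
    (hAc : ∀ ⦃f h : X → ℝ⦄ (c : ℝ), A f → A h → A (fun x => f x + c * h x))
    (hAK : ∀ ⦃f : X → ℝ⦄, A f → A (K f))
    (hlin : ∀ ⦃f h : X → ℝ⦄ (c : ℝ), A f → A h →
      ∀ x, K (fun s => f s + c * h s) x = K f x + c * K h x)
    (hsymm : ∀ ⦃f h : X → ℝ⦄, A f → A h →
      ∫ x, K f x * h x * w x ∂μ = ∫ x, f x * K h x * w x ∂μ)
    (hcontr : ∀ ⦃f : X → ℝ⦄, A f → ∫ x, K f x ^ 2 * w x ∂μ ≤ ∫ x, f x ^ 2 * w x ∂μ)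
    (hpos : ∀ ⦃f : X → ℝ⦄, A f → 0 ≤ ∫ x, f x * K f x * w x ∂μ)
    {u : X → ℝ} (hu : A u) (k : ℕ) :
    ∫ x, u x * (K^[k + 1] u) x * w x ∂μ ≤ ∫ x, u x * (K^[k] u) x * w x ∂μ := by
  -- even lags first
  have heven : ∀ m : ℕ, ∫ x, u x * (K^[2 * m + 1] u) x * w x ∂μ
      ≤ ∫ x, u x * (K^[2 * m] u) x * w x ∂μ := by
    intro m
    have hv := iterate_mem hAK m hu
    have h := integral_mul_op_le_sq hw0 hAi hAK hcontr hv
    rw [← Nat.add_zero (2 * m), ← autocov_shift hAK hsymm hu m 0, ← autocov_shift hAK hsymm hu m 1]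
    simp only [Function.iterate_zero, id_eq, Function.iterate_one, sq] at h ⊢
    exact h
  obtain ⟨m, rfl | rfl⟩ := Nat.even_or_odd' k
  · exact heven m
  · have hc := autocov_convex_of_pos hw0 hAi hAc hAK hlin hsymm hpos hu (2 * m + 1)
    have h2 := heven (m + 1)
    rw [show 2 * (m + 1) = 2 * m + 1 + 1 by ring, show 2 * m + 1 + 1 + 1 = 2 * m + 1 + 2 by ring]
      at h2
    linarith

/-- `a(k) ≤ a(0) = ∫ u² w`: under (pos) every autocovariance is at most the variance term. -/
theorem autocov_le_sq_of_pos (hw0 : ∀ x, 0 ≤ w x)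
    (hAi : ∀ ⦃f h : X → ℝ⦄, A f → A h → Integrable (fun x => f x * h x * w x) μ)
    (hAc : ∀ ⦃f h : X → ℝ⦄ (c : ℝ), A f → A h → A (fun x => f x + c * h x))
    (hAK : ∀ ⦃f : X → ℝ⦄, A f → A (K f))
    (hlin : ∀ ⦃f h : X → ℝ⦄ (c : ℝ), A f → A h →
      ∀ x, K (fun s => f s + c * h s) x = K f x + c * K h x)
    (hsymm : ∀ ⦃f h : X → ℝ⦄, A f → A h →
      ∫ x, K f x * h x * w x ∂μ = ∫ x, f x * K h x * w x ∂μ)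
    (hcontr : ∀ ⦃f : X → ℝ⦄, A f → ∫ x, K f x ^ 2 * w x ∂μ ≤ ∫ x, f x ^ 2 * w x ∂μ)
    (hpos : ∀ ⦃f : X → ℝ⦄, A f → 0 ≤ ∫ x, f x * K f x * w x ∂μ)
    {u : X → ℝ} (hu : A u) :
    ∀ k : ℕ, ∫ x, u x * (K^[k] u) x * w x ∂μ ≤ ∫ x, u x ^ 2 * w x ∂μ
  | 0 => by simp [sq]
  | k + 1 => (autocov_succ_le_of_pos hw0 hAi hAc hAK hlin hsymm hcontr hpos hu k).trans
      (autocov_le_sq_of_pos hw0 hAi hAc hAK hlin hsymm hcontr hpos hu k)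

/-- **Log-convexity**: `a(k+1)² ≤ a(k) a(k+2)` (even lags: Cauchy–Schwarz in `L²(w)` for
`⟨v, K v⟩`; odd lags: Cauchy–Schwarz for the positive form, `⟨v, K(Kv)⟩² ≤ ⟨v,Kv⟩⟨Kv,K Kv⟩`). -/
theorem autocov_logConvex_of_pos (hw0 : ∀ x, 0 ≤ w x)
    (hAi : ∀ ⦃f h : X → ℝ⦄, A f → A h → Integrable (fun x => f x * h x * w x) μ)
    (hAc : ∀ ⦃f h : X → ℝ⦄ (c : ℝ), A f → A h → A (fun x => f x + c * h x))
    (hAK : ∀ ⦃f : X → ℝ⦄, A f → A (K f))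
    (hlin : ∀ ⦃f h : X → ℝ⦄ (c : ℝ), A f → A h →
      ∀ x, K (fun s => f s + c * h s) x = K f x + c * K h x)
    (hsymm : ∀ ⦃f h : X → ℝ⦄, A f → A h →
      ∫ x, K f x * h x * w x ∂μ = ∫ x, f x * K h x * w x ∂μ)
    (hpos : ∀ ⦃f : X → ℝ⦄, A f → 0 ≤ ∫ x, f x * K f x * w x ∂μ)
    {u : X → ℝ} (hu : A u) (k : ℕ) :
    (∫ x, u x * (K^[k + 1] u) x * w x ∂μ) ^ 2
      ≤ (∫ x, u x * (K^[k] u) x * w x ∂μ) * ∫ x, u x * (K^[k + 2] u) x * w x ∂μ := by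
  obtain ⟨m, rfl | rfl⟩ := Nat.even_or_odd' k
  · have hv := iterate_mem hAK m hu
    have hKv := hAK hv
    have hCS := sq_integral_mul_le hw0 hAi hv hKv
    have e2 : ∫ x, K (K^[m] u) x ^ 2 * w x ∂μ
        = ∫ x, (K^[m] u) x * (K^[2] (K^[m] u)) x * w x ∂μ := by
      have h := two_time hAK hsymm hv 1 1
      simp only [Function.iterate_one] at h
      rw [← h]
      simp only [sq]
    rw [← Nat.add_zero (2 * m), ← autocov_shift hAK hsymm hu m 0,
      show 2 * m + 0 + 1 = 2 * m + 1 by ring, ← autocov_shift hAK hsymm hu m 1,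
      show 2 * m + 0 + 2 = 2 * m + 2 by ring, ← autocov_shift hAK hsymm hu m 2, ← e2]
    simp only [Function.iterate_zero, id_eq, Function.iterate_one, sq] at hCS ⊢
    simpa only [mul_assoc] using hCS
  · have hv := iterate_mem hAK m hu
    have hKv := hAK hv
    have hCS := kform_sq_le_of_pos hAi hAc hAK hlin hsymm hpos hv hKv
    have e3 : ∫ x, K (K^[m] u) x * K (K (K^[m] u)) x * w x ∂μ
        = ∫ x, (K^[m] u) x * (K^[3] (K^[m] u)) x * w x ∂μ := by
      have h := two_time hAK hsymm hv 1 2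
      simp only [Function.iterate_succ_apply', Function.iterate_zero, id_eq] at h ⊢
      exact h
    rw [← autocov_shift hAK hsymm hu m 1, show 2 * m + 1 + 1 = 2 * m + 2 by ring,
      ← autocov_shift hAK hsymm hu m 2, show 2 * m + 1 + 2 = 2 * m + 3 by ring,
      ← autocov_shift hAK hsymm hu m 3, ← e3]
    simp only [Function.iterate_succ_apply', Function.iterate_zero, id_eq] at hCS ⊢
    exact hCS

end RevOp

end Summit.Ventures.LatticeQCDFlow.Exactness
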